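import Mathlib.Algebra.BigOperators.Finprod
import Mathlib.SetTheory.Cardinal.NatCard
import HarnessLib

/-!
# Liu 2021: the Albanese of unitary Shimura varieties (typed skeleton of §4.2)

Yifeng Liu, *Fourier–Jacobi cycles and arithmetic relative trace formula* (with an appendix by Chao Li and
Yihang Zhu), Cambridge J. Math. 9 (2021), no. 1, 1–147 = arXiv:2102.11518 [Liu2021], §4.1 "Automorphic
characters and CM data", §4.2 "Albanese of unitary Shimura varieties".  WHAT IS REPRODUCED: the STATEMENTS of
Prop. 4.13 (the first Betti cohomology of the Albanese tower `A_∞ = lim_K Alb(Sh(𝕍)_K)` is the direct sum of the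
adèlic oscillator representations `ω(μ, ε, χ)`, `μ` of weight one, `ε` `μ`-admissible), Thm. 4.18 (2) (those
summands are mutually non-isomorphic) and Cor. 4.20 (the isogeny decomposition `A_K ∼ ∏_μ A_μ^{d(μ,K)}`), as TYPED
SKELETONS: predicates `def P (D : LiuAlbaneseDatum Isog) : Prop` over a hypothesis structure of BARE CARRIERS naming
exactly the objects the statements quantify over; NOTHING IS ASSERTED (a consumer takes `(h : D.P)` for its own
datum); one kernel consequence (multiplicity `≤ 1`) is proved.  Quotations AS PRINTED were read on the held arXiv
text (corpus key `paper:arxiv-2102.11518`, chunks p0018–p0023) and checked symbol by symbol against the author's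
TeX source (`FJcycle.tex`, arXiv e-print, 2021-06-19); theorem NUMBERS are those of the arXiv version (the
published numbering is unconfirmed).

Setting of [Liu2021, §4.2] (p0019 L61–p0020 L27): `E/F` a CM extension, `n ≥ 2`, `𝕍` a totally positive definite
INCOHERENT hermitian space over `𝔸_E` of rank `n`; `{Sh(𝕍)_K}_K` its unitary Shimura varieties over `E` (smooth,
quasi-projective, of dimension `n − 1`; projective in the Compact Case), `X_K` the toroidal compactification (= itself
in the Compact Case), `A_K := Alb(X_K)`, `A_∞ := lim_K A_K` with its Hecke action of `U(𝕍)(𝔸_F^∞)`,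
`H¹_{B,τ'}(A_∞, ℂ) := colim_K H¹_{B,τ'}(A_K, ℂ)`, "an admissible representation of `U(𝕍)(𝔸_F^∞)`", for every
embedding `τ' : E → ℂ`.

NOT here: the CM data `(A_μ, i_μ, λ_μ, r_μ)` of Def. 4.5 beyond the class `[A_μ]`, the `M_μ`-module
`Ω(μ) = colim Hom_E(A_∞, A_μ)_ℚ` of Def. 4.16 and items (1), (3) of Thm. 4.18 (they need Hom-spaces of abelian
varieties, for which the tree has no carrier at this level), the `n = 2` endoscopic variant of Cor. 4.20, proofs.

## References

* [Liu2021] Y. Liu, *Fourier–Jacobi cycles and arithmetic relative trace formula*, Camb. J. Math. 9 (2021) 1–147,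
  arXiv:2102.11518 — Def. 4.1, 4.3, 4.5, 4.11, 4.12, Prop. 4.13, Remark 4.14, Def. 4.16, Thm. 4.18, Cor. 4.20.
* [ShimuraIATAF1971] G. Shimura, *Introduction to the arithmetic theory of automorphic functions* (1971), Thm 5/6 —
  existence of `A_μ` (quoted by Liu; not used here).
* [MurtyRamakrishnan1992], [GelbartRogawski1991] — inputs of Liu's proof of Prop. 4.13 / Remark 4.14 (not used here).
-/

namespace Literature.AlgebraicGeometry.Liu2021

universe u w

/-- **Carriers for [Liu2021, §4.1–4.2]** (a hypothesis structure; the isogeny monoid `Isog` of abelian varieties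
over `E` — additive, `[A × B] = [A] + [B]` — is a parameter, its monoid structure an instance argument of the
statement that uses it).
* `Char` — the conjugate-symplectic automorphic characters `μ : E^×\𝔸_E^× → ℂ^×` of WEIGHT ONE.  AS PRINTED,
  Def. 4.1 (p0018 L25–27): "We say that an automorphic character `μ : E^×\𝔸_E^× → ℂ^×` is conjugate self-dual if
  `μ` is trivial on `N_{𝔸_E/𝔸_F} 𝔸_E^×`. We say that `μ` is conjugate orthogonal (resp. conjugate symplectic) if
  `μ|_{𝔸_F^×} = 1` (resp. `μ|_{𝔸_F^×} = μ_{E/F}`)."; Remark 4.2 + Def. 4.3 (p0018 L29–42): "For a conjugate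
  symplectic (resp. conjugate orthogonal) automorphic character `μ`, there exist a CM type `Φ_μ` and a unique tuple
  `𝚠_μ = (𝚠_τ)_{τ ∈ Φ_F}` of odd (resp. even) nonnegative integers such that for every `τ ∈ Φ_F`, the component
  `μ_τ : (E ⊗_{F,τ} ℝ)^× → ℂ^×` is the character `z ↦ arg(z)^{−𝚠_τ}`, where we have identified `(E ⊗_{F,τ} ℝ)^×`
  with `ℂ^×` via the unique element `τ' ∈ Φ_μ` above `τ`. If `𝚠_μ` does not contain `0`, then `Φ_μ` is also
  unique. … We call `𝚠_μ` the weight of `μ`. … If `𝚠_μ` does not contain zero, then we call `Φ_μ` the CM type of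
  `μ`. Furthermore, we denote by `M'_μ ⊆ ℂ` the reflex field of `(E, Φ_μ)`, with the induced CM type `Ψ_μ`";
  "`μ^{alg} := μ·|·|_E^{−1/2}` … Denote by `M_μ ⊆ ℂ` the subfield generated by values `μ^{alg}(x)` for
  `x ∈ (𝔸_E^∞)^×`, which is a number field containing `M'_μ`."
* `Adm μ` — the pairs `(ε, χ)` completing `μ` to an adèlic oscillator triple with `ε` `μ`-ADMISSIBLE.  AS PRINTED,
  Def. 4.11 (p0020 L29–42): "An adèlic oscillator triple is a triple `(μ, ε, χ)` consisting of • a conjugate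
  symplectic automorphic character `μ = ⊗ μ_v` …, • a collection `ε = (ε_v ∈ E_v^{×,−}/N_{E_v/F_v} E_v^×)_v` for
  every nonarchimedean place `v` of `F` such that `ε_v ∈ 𝒪_{E_v}^× N_{E_v/F_v} E_v^×` for all but finitely many `v`,
  and • an automorphic character `χ = ⊗ χ_v : E¹\(𝔸_E^∞)¹ → ℂ^×` … the adèlic oscillator representation attached
  to `(μ, ε, χ)`, `ω(μ, ε, χ) := ⊗'_v ω(μ_v, ε_v, χ_v)`, which is an irreducible admissible representation of
  `U(𝕍)(𝔸_F^∞)`."; Def. 4.12 (p0020 L44–51): "we say that `ε` is `μ`-admissible if there exists some `e ∈ E^{×,−}`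
  such that • `ε_v = e N_{E_v/F_v} E_v^×` for every nonarchimedean place `v` of `F`, and • `τ'(e)` has negative
  imaginary part for every `τ' ∈ Φ_μ`."
* `Rep` — isomorphism classes of irreducible admissible `ℂ[U(𝕍)(𝔸_F^∞)]`-modules; `omega μ a = ω(μ, ε, χ)`.
* `Emb` — embeddings `τ' : E → ℂ`; `H1mult τ' ρ` — the multiplicity of `ρ` in the admissible representation
  `H¹_{B,τ'}(A_∞, ℂ)`.
* `Level` — sufficiently small open compact `K ⊆ U(𝕍)(𝔸_F^∞)`; `invDim ρ K = dim ρ^K`.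
* `alb K = [A_K] ∈ Isog`; `Amu μ = [A_μ]`, `A_μ` the CM abelian variety over `E` of a CM datum for `μ` (Def. 4.5 /
  Prop. 4.6, p0018 L53 ff.; existence by Shimura 1971 Thm 5/6); `isRep μ` — `μ` is the chosen representative of its
  `Gal(ℂ/ℚ)`-orbit (Cor. 4.20; `\Gal(\dC/\dQ)` is the source's notation for `Aut(ℂ/ℚ)`); `d μ K = d(μ, K)`;
  `n` — the rank of `𝕍`.
[cite: Liu2021, §4.1–4.2 (Def. 4.1, 4.3, 4.5, 4.11, 4.12)] -/
structure LiuAlbaneseDatum (Isog : Type w) where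
  /-- weight-one conjugate-symplectic automorphic characters of `𝔸_E^×` -/
  Char : Type u
  /-- `μ`-admissible completions `(ε, χ)` -/
  Adm : Char → Type u
  /-- irreducible admissible `U(𝕍)(𝔸_F^∞)`-modules up to isomorphism -/
  Rep : Type u
  /-- `ω(μ, ε, χ)` -/
  omega : (μ : Char) → Adm μ → Rep
  /-- embeddings `τ' : E → ℂ` -/
  Emb : Type u
  /-- multiplicity of `ρ` in `H¹_{B,τ'}(A_∞, ℂ)` -/
  H1mult : Emb → Rep → ℕ
  /-- levels `K` -/
  Level : Type u
  /-- `dim ρ^K` -/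
  invDim : Rep → Level → ℕ
  /-- `[A_K] = [Alb X_K]` -/
  alb : Level → Isog
  /-- `[A_μ]` -/
  Amu : Char → Isog
  /-- orbit representatives -/
  isRep : Char → Prop
  /-- `d(μ, K)` -/
  d : Char → Level → ℕ
  /-- `n = rank 𝕍` -/
  n : ℕ

namespace LiuAlbaneseDatum

variable {Isog : Type w}

/-- **[Liu2021, Prop. 4.13]** (p0020 L53–57), AS PRINTED: "Suppose that `n ≥ 3`. Then for every embedding
`τ' : E → ℂ`, there is an isomorphism `H¹_{B,τ'}(A_∞, ℂ) ≅ ⊕_{(μ,ε,χ)} ω(μ, ε, χ)` of `ℂ[U(𝕍)(𝔸_F^∞)]`-modules,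
where the direct sum is taken over all adèlic oscillator triples in which `μ` is of weight one and `ε` is
`μ`-admissible."  (Remark 4.14: "When `n = 3`, Proposition 4.13 can be deduced from [GR91, Rog92].")
TYPING: as the MULTIPLICITY statement for the admissible module `H¹_{B,τ'}(A_∞, ℂ)`: the multiplicity of an
irreducible `ρ` is the number of admissible weight-one triples `t` with `ω(t) ≅ ρ` (`Nat.card`; `= 0` if that set
were infinite).  This reading of the displayed direct sum USES that each summand `ω(μ, ε, χ)` is IRREDUCIBLE, which
is Def. 4.11 as quoted in the structure docstring.
[cite: Liu2021, Prop. 4.13] -/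
def Prop413 (D : LiuAlbaneseDatum.{u, w} Isog) : Prop :=
  3 ≤ D.n → ∀ (τ' : D.Emb) (ρ : D.Rep),
    D.H1mult τ' ρ = Nat.card {t : (μ : D.Char) × D.Adm μ // D.omega t.1 t.2 = ρ}

/-- **[Liu2021, Thm. 4.18 (2)]** (p0022 L107–113), AS PRINTED (main statement and items): "There is an isomorphism
`Ω(μ) ⊗_{M_μ} ℂ ≅ ⊕_ε ⊕_χ ω(μ, ε, χ)` of `ℂ[U(𝕍)(𝔸_F^∞)]`-modules, where the direct sum is taken over all `ε, χ`
such that `ε` is `μ`-admissible. Moreover, (1) For every object `D_μ = (A_μ, i_μ, λ_μ, r_μ) ∈ 𝒜(μ)`, we have a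
canonical isomorphism `Ω(μ)^K ≅ Hom_E(A_K, A_μ)_ℚ` for every sufficiently small open compact subgroup
`K ⊆ U(𝕍)(𝔸_F^∞)`. (2) The `ℂ[U(𝕍)(𝔸_F^∞)]`-modules in the direct sum … are mutually non-isomorphic. (3) For every
given `ε` that is `μ`-admissible, the subspace `⊕_χ ω(μ, ε, χ)` is stable under the action of `Gal(ℂ/M_μ)`."
(Def. 4.16: "`Ω(μ) := colim_{D_μ ∈ 𝒜(μ)} Hom_E(A_∞, A_μ)_ℚ` in the category of `M_μ[U(𝕍)(𝔸_F^∞)]`-modules".)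
TYPING: ONLY item (2) is typed (injectivity of `(ε, χ) ↦ ω(μ, ε, χ)` on admissible pairs); the main isomorphism and
items (1), (3) are recorded above, not typed.
[cite: Liu2021, Thm. 4.18 (2)] -/
def Thm418_2 (D : LiuAlbaneseDatum.{u, w} Isog) : Prop :=
  ∀ (μ : D.Char) (a b : D.Adm μ), D.omega μ a = D.omega μ b → a = b

/-- **[Liu2021, Cor. 4.20]** (p0023 L45–55), AS PRINTED: "Take an arbitrary object `D_μ = (A_μ, i_μ, λ_μ, r_μ) ∈
𝒜(μ)`. For every sufficiently small open compact subgroup `K` of `U(𝕍)(𝔸_F^∞)`, there is an isogeny decomposition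
`A_K ∼ ∏_μ A_μ^{d(μ,K)}`, resp. `A_K^{end} ∼ ∏_μ A_μ^{d(μ,K)}` of abelian varieties over `E` when `n ≥ 3` (resp.
`n = 2`), where the product is taken over representatives of `Gal(ℂ/ℚ)`-orbits of all conjugate symplectic
automorphic characters of `𝔸_E^×` of weight one. Here, `A_K^{end}` is the endoscopic part of `A_K` when `n = 2` …
and `d(μ, K) := Σ_ε Σ_χ dim ω(μ, ε, χ)^K`, where the sum is taken over all `ε, χ` such that `ε` is
`μ`-admissible." (= [Liu2021, Thm. 1.1], p0004 L1–17.)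
TYPING: in the isogeny monoid, `[A_K] = Σ_{μ representative} d(μ,K) • [A_μ]` (a `finsum`: finitely many `μ` have
`d(μ,K) ≠ 0`), and `d(μ,K) = Σ_{(ε,χ) admissible} dim ω(μ,ε,χ)^K` (a `finsum`) — the `n ≥ 3` clause only; the
`n = 2` endoscopic variant is not typed.
[cite: Liu2021, Cor. 4.20] -/
def Cor420 [AddCommMonoid Isog] (D : LiuAlbaneseDatum.{u, w} Isog) : Prop :=
  3 ≤ D.n →
    (∀ K : D.Level, D.alb K = ∑ᶠ μ : {μ : D.Char // D.isRep μ}, D.d μ.1 K • D.Amu μ.1) ∧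
    ∀ (μ : D.Char) (K : D.Level), D.d μ K = ∑ᶠ a : D.Adm μ, D.invDim (D.omega μ a) K

/-- **Multiplicity one, kernel-checked from Prop. 4.13 + Thm. 4.18 (2).**  If distinct `μ` never give isomorphic
oscillator representations (`ω(μ,ε,χ)` determines `μ` through its local components — NOT printed as such in
[Liu2021]; carried as the explicit hypothesis `hμ`), then every irreducible occurs in `H¹_{B,τ'}(A_∞, ℂ)` with
multiplicity `≤ 1` (cf. the proof of Prop. 4.13: "the dimension of `H¹_{B,τ'}(A_∞,ℂ)[ω(μ,ε,χ)]` is `1`").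
[folklore] -/
theorem Prop413.mult_le_one {D : LiuAlbaneseDatum.{u, w} Isog} (h : D.Prop413) (h2 : D.Thm418_2)
    (hn : 3 ≤ D.n)
    (hμ : ∀ (μ μ' : D.Char) (a : D.Adm μ) (b : D.Adm μ'), D.omega μ a = D.omega μ' b → μ = μ')
    (τ' : D.Emb) (ρ : D.Rep) : D.H1mult τ' ρ ≤ 1 := by
  rw [h hn τ' ρ]
  haveI : Subsingleton {t : (μ : D.Char) × D.Adm μ // D.omega t.1 t.2 = ρ} := by
    refine ⟨fun x y => Subtype.ext ?_⟩
    obtain ⟨⟨μ, a⟩, hx⟩ := x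
    obtain ⟨⟨μ', b⟩, hy⟩ := y
    have hμμ' : μ = μ' := hμ μ μ' a b (hx.trans hy.symm)
    subst hμμ'
    have hab : a = b := h2 μ a b (hx.trans hy.symm)
    subst hab
    rfl
  exact Finite.card_le_one_iff_subsingleton.mpr inferInstance

end LiuAlbaneseDatum

end Literature.AlgebraicGeometry.Liu2021
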